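/-
Copyright: the b2b-balaban T⁴-continuum CRUX team, row NE7b leaf lineage `t4-ne7b-formalise-leaf-06` (gen 151). Project licence.
-/
import Summits.QuantumFields.BalabanUV.T4Continuum.Spine.NE7b.AnalyticThirdDerivLetter
import Summits.QuantumFields.BalabanUV.T4Continuum.Spine.NE7b.ConvexWindowSuppliersLocal

/-!
# THE THIRD-DERIVATIVE TABLE OF A LOCAL ANALYTIC TERM: a functional holomorphic and bounded by `M` on a complex `δ`-neighbourhood that
# depends only on the coordinates in `S` has, on `ℓ²` fields, third-derivative entries `D³P(z)[e_a, e_b, e_c]` that VANISH unless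
# `a, b, c ∈ S` and are `≤ 27M∕δ³` always — the `hsupp` ∕ `hτb` pair of `…ConvexWindowSuppliersLocal.thirdDeriv_supNorm_of_local`
# in print's currency `(M, δ, S)`, so that the mixed constant `c∞` of ONE local analytic term is `|S|³·27M∕δ³` BY NAME
# (row NE7b, node U5c; letter (ℓ1) of the windowed road; the order-three sibling of `…AnalyticHessianLetterLocal`; [folklore])

Cell `pub-balaban`, sub-cell `t4`, spine estimate NE7b (`T4WeightBudget.RelWeightBound`; the cell's OWN estimate — NOT PRINTED in
[Bałaban 1983–89], NOT PROVED).  Crux-route work under `Spine/NE7b/` by a row leaf on the convexity road; NOTHING of Bałaban's is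
named, valued or asserted; no `T4Continuum/Support` leaf typed; no `def`; zero `sorry`.  Imports: the sibling `…AnalyticThirdDerivLetter`
(slices, `polarization_three`, Schwarz, the chart letter — BY NAME) and leaf-02's `…ConvexWindowSuppliersLocal` (the socket, BY NAME).

WHY.  The road's LOCAL third-derivative socket (`…ConvexWindowSuppliersLocal`, leaf-02; refuter κ-ne7bref-g72-4 «`c₃^{(∞)}` intensive
for a local `P`») displays, for a perturbation `P` ON the window, an interaction set `N` of index triples off which the entries
`D³P(z)[e_{r0}, e_{r1}, e_{r2}]` VANISH (`hsupp`), a bound `τ` on the live entries (`hτb`) and a count `ν` of live triples through each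
index (`hrow` ∕ `hcol`), and returns the mixed letter `‖D³P(z)[w,·,·]‖_op ≤ ν·τ·‖w‖_∞` — no `√n`.  Print's effective actions are sums
of LOCAL ANALYTIC terms: each `E_p` is holomorphic with a sup bound on a complex neighbourhood and depends only on the fields in a
bounded set `S_p` of sites ([B12] CMP 109 §1 (1.13) ∕ (1.18): `E^{(j)}(X)` depends on `(U, J)|_X` — read BY SHAPE only).  The sibling
`…AnalyticThirdDerivLetter` turned the sup bound into `|D³P(z)[u,v,w]| ≤ 27M∕δ³·‖u‖‖v‖‖w‖`; THIS FILE adds LOCALITY at order three —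
coordinate dependence ⟹ slice dependence ⟹ (diagonal third derivatives of equal slices agree, then cubic polarization) the mixed
third derivative sees each direction only through its `S`-coordinates — and delivers the socket's `hsupp` ∕ `hτb` for ONE term from
`(M, δ, S)`, with the END by name: `c∞ = |S|³·27M∕δ³` (the trivial count `ν ≤ |S³|`; sums of terms add entrywise — the consumer's step,
as in `…AnalyticHessianLetterLocal` §5 for order two).

WHAT IS PROVED ([folklore]):
* §1 SLICES (any real normed spaces `V`, `V′`; `P ∈ C³(O)`, `Q ∈ C³(O′)`, `O ∋ x`, `O′ ∋ x′` open): `fderiv_three_diag_eq_of_slices`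
  (`P(x + s z) = Q(x′ + s z′)` near `s = 0` ⟹ `D³P(x)[z,z,z] = D³Q(x′)[z′,z′,z′]`), **`fderiv_three_eq_of_slices`** (slices along
  `a u + b v + c w` and `a u′ + b v′ + c w′` agree for all `(a,b,c)` ⟹ `D³P(x)[u,v,w] = D³Q(x′)[u′,v′,w′]` — the four polarization points),
  `fderiv_three_congr_fst_of_slices` (one space, first slot).
* §2 ONE LOCAL ANALYTIC TERM ON `ℓ²` (`E : ℂⁿ → ℂ` of class `C³` over `ℂ` on an open `U`, `hloc : E z = E z′` whenever `z|_S = z′|_S`,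
  `P y = Re E(↑y)` on `EuclideanSpace ℝ (Fin n)`): `slice_eq_of_local`, **`fderiv_three_congr_fst_of_local`** (`u|_S = u′|_S ⟹
  D³P(x)[u,v,w] = D³P(x)[u′,v,w]`), **`iteratedFDeriv_three_single_eq_zero_of_local`** (some `r s ∉ S` ⟹
  `D³P(x)[e_{r0},e_{r1},e_{r2}] = 0` — Schwarz moves the dead slot to the front; `e_a = EuclideanSpace.single a 1`),
  **`abs_iteratedFDeriv_three_single_le`** (`‖E‖ ≤ M` on `U`, closed `δ`-polydisc about `↑x` in `U` ⟹ every entry `≤ 27M∕δ³`; the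
  contractive `ℓ² → ℓ^∞` complexification chart, inlined).
* §3 THE END BY NAME: `card_filter_piFinset_le` (`≤ |S|³` live triples through any index) and **`thirdDeriv_supNorm_of_analyticLocal`** =
  `…ConvexWindowSuppliersLocal.thirdDeriv_supNorm_of_local` with `N := S³` (`Fintype.piFinset`), `τ := 27M∕δ³`, `ν := |S|³`:
  `∀ z ∈ K, ∀ w, ‖D³P(z)[w,·,·]‖_op ≤ (|S|³·27M∕δ³)·‖w‖_∞` on any real window `K` whose closed complex `δ`-polydiscs lie in `U`.

NOT HERE (honest): sums of terms and the overlap count (entries add; `ν` becomes the lattice-geometric number of live triples through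
a site — the consumer's bookkeeping with `…ConvexWindowSuppliersLocal.fibreSum_le_of_local` ∕ `…Cells`); the sharp per-index count
`|S|²` and the sharp polydisc constants; the sup-norm lattice (`ι → ℝ`) spelling of the vanishing (the sibling's §6 has the bound); the
global `ContDiff ℝ 3 P` that the Box∕Local CONVEXITY ends still display (the table itself needs none — `thirdDeriv_supNorm_of_local` is
pure multilinear algebra at each `z`); WHICH terms of print with WHICH `(M, δ, S_p)` — (A3) ∕ (A1c), NC-NE7b-α UNRULED; no toy (the
hypotheses are the sibling's plus `hloc`, inhabited by any `E` factoring through the `S`-coordinates); anything of Bałaban's.  BY-NAME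
EFFECT ON THE WALL: NONE.  NE7b NOT PRINTED ∕ NOT PROVED; spine PROVED 0∕9; rung (B)+1 on a FINITE torus — NOT infinite volume, NOT
the mass gap, NOT Clay.
HONEST DEPENDENCY: continuum YM on T⁴ ⇐ BetaPertH ∧ nine spine estimates (0/9 proved); BetaPertH ⇐ (D1) ∧ (D4) ∧ CAP+tail.
-/

set_option autoImplicit false

open Set Filter Metric Topology
open Summit.QuantumFields.BalabanUV.T4Continuum.NE7b.AnalyticThirdDerivLetter

namespace Summit.QuantumFields.BalabanUV.T4Continuum.NE7b.AnalyticThirdDerivLetterLocal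

/-! ## §1 Locality of the third derivative from slice locality (any real normed spaces) -/

section Slices

variable {V : Type*} [NormedAddCommGroup V] [NormedSpace ℝ V] {V' : Type*} [NormedAddCommGroup V'] [NormedSpace ℝ V']

/-- **EQUAL SLICES, EQUAL DIAGONAL THIRD DERIVATIVES** (across two spaces): `P ∈ C³(O)`, `Q ∈ C³(O′)` on open sets through `x`, `x′`,
and `P(x + s z) = Q(x′ + s z′)` for `s` near `0` ⟹ `D³P(x)[z,z,z] = D³Q(x′)[z′,z′,z′]` (both are the third derivative of the common
slice at `0`, the sibling's `iteratedDeriv_lineSlice`). [folklore] -/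
theorem fderiv_three_diag_eq_of_slices {P : V → ℝ} {O : Set V} (hO : IsOpen O) (hP : ContDiffOn ℝ 3 P O) {x : V} (hx : x ∈ O)
    {Q : V' → ℝ} {O' : Set V'} (hO' : IsOpen O') (hQ : ContDiffOn ℝ 3 Q O') {x' : V'} (hx' : x' ∈ O') {z : V} {z' : V'}
    (h : ∀ᶠ s : ℝ in 𝓝 0, P (x + s • z) = Q (x' + s • z')) :
    fderiv ℝ (fderiv ℝ (fderiv ℝ P)) x z z z = fderiv ℝ (fderiv ℝ (fderiv ℝ Q)) x' z' z' z' := by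
  have e := Filter.EventuallyEq.iteratedDeriv_eq 3 h
  rw [iteratedDeriv_lineSlice hO hP hx z, iteratedDeriv_lineSlice hO' hQ hx' z'] at e
  simpa only [iteratedFDeriv_three_apply] using e

/-- **EQUAL SLICES, EQUAL MIXED THIRD DERIVATIVES**: if the slices along `u ± v ± w` and `u′ ± v′ ± w′` agree near `0` (asked for all
real coefficient triples `(a, b, c)`, which is how locality delivers it), then `D³P(x)[u,v,w] = D³Q(x′)[u′,v′,w′]` — the diagonal case
at the four polarization points and the sibling's `polarization_three` on both sides. [folklore] -/
theorem fderiv_three_eq_of_slices {P : V → ℝ} {O : Set V} (hO : IsOpen O) (hP : ContDiffOn ℝ 3 P O) {x : V} (hx : x ∈ O)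
    {Q : V' → ℝ} {O' : Set V'} (hO' : IsOpen O') (hQ : ContDiffOn ℝ 3 Q O') {x' : V'} (hx' : x' ∈ O') {u v w : V} {u' v' w' : V'}
    (h : ∀ a b c : ℝ, ∀ᶠ s : ℝ in 𝓝 0, P (x + s • (a • u + b • v + c • w)) = Q (x' + s • (a • u' + b • v' + c • w'))) :
    fderiv ℝ (fderiv ℝ (fderiv ℝ P)) x u v w = fderiv ℝ (fderiv ℝ (fderiv ℝ Q)) x' u' v' w' := by
  have hPat : ContDiffAt ℝ 3 P x := hP.contDiffAt (hO.mem_nhds hx)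
  have hQat : ContDiffAt ℝ 3 Q x' := hQ.contDiffAt (hO'.mem_nhds hx')
  have k := fun a b c => fderiv_three_diag_eq_of_slices hO hP hx hO' hQ hx' (h a b c)
  have k1 := k 1 1 1
  have k2 := k 1 1 (-1)
  have k3 := k 1 (-1) 1
  have k4 := k 1 (-1) (-1)
  simp only [one_smul, neg_smul, ← sub_eq_add_neg] at k1 k2 k3 k4
  have p1 := polarization_three hPat u v w
  have p2 := polarization_three hQat u' v' w'
  linarith

/-- **ONE SPACE, FIRST SLOT**: if the slices of `P` along `a u + b v + c w` and `a u′ + b v + c w` agree near `0` for all `(a, b, c)`, then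
`D³P(x)[u,v,w] = D³P(x)[u′,v,w]`; with Schwarz (`fderiv_three_symm`) the same serves the other two slots. [folklore] -/
theorem fderiv_three_congr_fst_of_slices {P : V → ℝ} {O : Set V} (hO : IsOpen O) (hP : ContDiffOn ℝ 3 P O) {x : V} (hx : x ∈ O)
    {u u' v w : V} (h : ∀ a b c : ℝ, ∀ᶠ s : ℝ in 𝓝 0, P (x + s • (a • u + b • v + c • w)) = P (x + s • (a • u' + b • v + c • w))) :
    fderiv ℝ (fderiv ℝ (fderiv ℝ P)) x u v w = fderiv ℝ (fderiv ℝ (fderiv ℝ P)) x u' v w :=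
  fderiv_three_eq_of_slices hO hP hx hO hP hx h

end Slices

/-! ## §2 A local analytic term on `ℓ²` fields: `P y = Re E(↑y)`, `E` depending only on the coordinates in `S` -/

section Euclidean

variable {n : ℕ} {E : (Fin n → ℂ) → ℂ} {U : Set (Fin n → ℂ)} {M : ℝ}

/-- **SLICE LOCALITY FROM COORDINATE LOCALITY**: if `E z = E z′` whenever `z` and `z′` agree on `S`, then for `ℓ²` directions `u, u′`
agreeing on `S` the slices of `P = Re E(↑·)` through `x` along `a u + b v + c w` and `a u′ + b v + c w` coincide (for every `s`). [folklore] -/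
theorem slice_eq_of_local (S : Finset (Fin n)) (hloc : ∀ z z' : Fin n → ℂ, (∀ i ∈ S, z i = z' i) → E z = E z')
    (x : EuclideanSpace ℝ (Fin n)) {u u' : EuclideanSpace ℝ (Fin n)} (huu : ∀ i ∈ S, u i = u' i) (v w : EuclideanSpace ℝ (Fin n))
    (a b c s : ℝ) :
    (E (fun i => ((x + s • (a • u + b • v + c • w)) i : ℂ))).re = (E (fun i => ((x + s • (a • u' + b • v + c • w)) i : ℂ))).re := by
  congr 1
  refine hloc _ _ fun i hi => ?_
  simp [PiLp.add_apply, PiLp.smul_apply, huu i hi]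

/-- **THE FIRST SLOT SEES ITS DIRECTION ONLY THROUGH `S`**: `E ∈ C³(U)` over `ℂ` on an open `U`, depending only on the coordinates in
`S`; `↑x ∈ U`; `u, u′ : ℓ²` agreeing on `S` ⟹ `D³P(x)[u,v,w] = D³P(x)[u′,v,w]` for `P y = Re E(↑y)`. [folklore] -/
theorem fderiv_three_congr_fst_of_local (hU : IsOpen U) (hE : ContDiffOn ℂ 3 E U) (S : Finset (Fin n))
    (hloc : ∀ z z' : Fin n → ℂ, (∀ i ∈ S, z i = z' i) → E z = E z') {x : EuclideanSpace ℝ (Fin n)}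
    (hx : (fun i => (x i : ℂ)) ∈ U) {u u' : EuclideanSpace ℝ (Fin n)} (huu : ∀ i ∈ S, u i = u' i) (v w : EuclideanSpace ℝ (Fin n)) :
    fderiv ℝ (fderiv ℝ (fderiv ℝ (fun y : EuclideanSpace ℝ (Fin n) => (E (fun i => (y i : ℂ))).re))) x u v w =
      fderiv ℝ (fderiv ℝ (fderiv ℝ (fun y : EuclideanSpace ℝ (Fin n) => (E (fun i => (y i : ℂ))).re))) x u' v w := by
  -- the `ℓ² → ℓ^∞(ℂ)` complexification chart and the regularity letter on its open preimage (the siblings' plumbing, inlined)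
  set J : EuclideanSpace ℝ (Fin n) →L[ℝ] (Fin n → ℂ) :=
    ContinuousLinearMap.pi fun i => Complex.ofRealCLM.comp (EuclideanSpace.proj i) with hJ
  have hJa : ∀ y : EuclideanSpace ℝ (Fin n), J y = fun i => (y i : ℂ) := fun y => by ext i; simp [hJ]
  have hO : IsOpen (J ⁻¹' U) := hU.preimage J.continuous
  have hP : ContDiffOn ℝ 3 (fun y : EuclideanSpace ℝ (Fin n) => (E (fun i => (y i : ℂ))).re) (J ⁻¹' U) := by
    have h := (Complex.reCLM.contDiff.comp_contDiffOn (hE.restrict_scalars ℝ)).comp J.contDiff.contDiffOn (mapsTo_preimage J U)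
    refine h.congr fun y _ => ?_
    simp only [Function.comp_apply, hJa, Complex.reCLM_apply]
  have hxO : x ∈ J ⁻¹' U := by simpa [hJa] using hx
  exact fderiv_three_congr_fst_of_slices hO hP hxO fun a b c =>
    Filter.Eventually.of_forall fun s => slice_eq_of_local S hloc x huu v w a b c s

/-- **THE TABLE, VANISHING ENTRIES**: `E ∈ C³(U)` over `ℂ`, depending only on the coordinates in `S`, `↑x ∈ U`; an index triple `r` with
SOME `r s ∉ S` ⟹ `D³P(x)[e_{r 0}, e_{r 1}, e_{r 2}] = 0` (`e_a = EuclideanSpace.single a 1`) — the `hsupp` letter of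
`…ConvexWindowSuppliersLocal.thirdDeriv_supNorm_of_local` with `N = S³`. [folklore] -/
theorem iteratedFDeriv_three_single_eq_zero_of_local (hU : IsOpen U) (hE : ContDiffOn ℂ 3 E U) (S : Finset (Fin n))
    (hloc : ∀ z z' : Fin n → ℂ, (∀ i ∈ S, z i = z' i) → E z = E z') {x : EuclideanSpace ℝ (Fin n)}
    (hx : (fun i => (x i : ℂ)) ∈ U) {r : Fin 3 → Fin n} (hr : ∃ s, r s ∉ S) :
    iteratedFDeriv ℝ 3 (fun y : EuclideanSpace ℝ (Fin n) => (E (fun i => (y i : ℂ))).re) x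
      (fun s => EuclideanSpace.single (r s) (1 : ℝ)) = 0 := by
  set P := fun y : EuclideanSpace ℝ (Fin n) => (E (fun i => (y i : ℂ))).re with hPdef
  set B := fderiv ℝ (fderiv ℝ (fderiv ℝ P)) x with hB
  -- a coordinate vector off `S` agrees with `0` on `S`
  have hoff : ∀ a : Fin n, a ∉ S → ∀ i ∈ S, (EuclideanSpace.single a (1 : ℝ)) i = (0 : EuclideanSpace ℝ (Fin n)) i := by
    intro a ha i hi
    have hia : i ≠ a := fun h => ha (h ▸ hi)
    simp [hia]
  have hzero : ∀ a : Fin n, a ∉ S → ∀ v w : EuclideanSpace ℝ (Fin n), B (EuclideanSpace.single a 1) v w = 0 := by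
    intro a ha v w
    rw [hB, fderiv_three_congr_fst_of_local hU hE S hloc hx (hoff a ha) v w]
    simp
  -- regularity at `x` for Schwarz
  set J : EuclideanSpace ℝ (Fin n) →L[ℝ] (Fin n → ℂ) :=
    ContinuousLinearMap.pi fun i => Complex.ofRealCLM.comp (EuclideanSpace.proj i) with hJ
  have hJa : ∀ y : EuclideanSpace ℝ (Fin n), J y = fun i => (y i : ℂ) := fun y => by ext i; simp [hJ]
  have hPat : ContDiffAt ℝ 3 P x := by
    have hO : IsOpen (J ⁻¹' U) := hU.preimage J.continuous
    have h := (Complex.reCLM.contDiff.comp_contDiffOn (hE.restrict_scalars ℝ)).comp J.contDiff.contDiffOn (mapsTo_preimage J U)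
    have hP' : ContDiffOn ℝ 3 P (J ⁻¹' U) := h.congr fun y _ => by
      simp only [hPdef, Function.comp_apply, hJa, Complex.reCLM_apply]
    exact hP'.contDiffAt (hO.mem_nhds (by simpa [hJa] using hx))
  rw [iteratedFDeriv_three_apply]
  obtain ⟨s, hs⟩ := hr
  fin_cases s
  · exact hzero _ hs _ _
  · rw [(fderiv_three_symm hPat (EuclideanSpace.single (r 1) (1 : ℝ)) (EuclideanSpace.single (r 0) (1 : ℝ))
      (EuclideanSpace.single (r 2) (1 : ℝ))).1]
    exact hzero _ hs _ _
  · rw [(fderiv_three_symm hPat (EuclideanSpace.single (r 0) (1 : ℝ)) (EuclideanSpace.single (r 2) (1 : ℝ))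
      (EuclideanSpace.single (r 1) (1 : ℝ))).2,
      (fderiv_three_symm hPat (EuclideanSpace.single (r 2) (1 : ℝ)) (EuclideanSpace.single (r 0) (1 : ℝ))
      (EuclideanSpace.single (r 1) (1 : ℝ))).1]
    exact hzero _ hs _ _

/-- **THE TABLE, BOUNDED ENTRIES**: `E ∈ C³(U)` over `ℂ` with `‖E‖ ≤ M` on `U` and the closed sup-norm `δ`-polydisc about `↑x` inside `U`
⟹ `|D³P(x)[e_{r 0}, e_{r 1}, e_{r 2}]| ≤ 27M∕δ³` for EVERY index triple (`ℓ²` coordinate vectors have norm `1`; the sibling's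
`abs_fderiv_three_chart_le` through the contractive `ℓ² → ℓ^∞` chart) — the `hτb` letter. [folklore] -/
theorem abs_iteratedFDeriv_three_single_le (hU : IsOpen U) (hE : ContDiffOn ℂ 3 E U) (hM : ∀ q ∈ U, ‖E q‖ ≤ M)
    {x : EuclideanSpace ℝ (Fin n)} {δ : ℝ} (hδ : 0 < δ) (hsub : closedBall (fun i => (x i : ℂ)) δ ⊆ U) (r : Fin 3 → Fin n) :
    |iteratedFDeriv ℝ 3 (fun y : EuclideanSpace ℝ (Fin n) => (E (fun i => (y i : ℂ))).re) x
      (fun s => EuclideanSpace.single (r s) (1 : ℝ))| ≤ 27 * M / δ ^ 3 := by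
  set J : EuclideanSpace ℝ (Fin n) →L[ℝ] (Fin n → ℂ) :=
    ContinuousLinearMap.pi fun i => Complex.ofRealCLM.comp (EuclideanSpace.proj i) with hJ
  have hJa : ∀ y : EuclideanSpace ℝ (Fin n), J y = fun i => (y i : ℂ) := fun y => by ext i; simp [hJ]
  have hJn : ∀ y : EuclideanSpace ℝ (Fin n), ‖J y‖ ≤ ‖y‖ := fun y => by
    rw [hJa]
    exact (pi_norm_le_iff_of_nonneg (norm_nonneg y)).2 fun i => by simpa using PiLp.norm_apply_le y i
  have hP : (fun y : EuclideanSpace ℝ (Fin n) => (E (fun i => (y i : ℂ))).re) = fun y => (E (J y)).re := by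
    funext y; rw [hJa]
  rw [hP, iteratedFDeriv_three_apply]
  have h := abs_fderiv_three_chart_le J hJn hU hE hM hδ (by rwa [hJa]) (EuclideanSpace.single (r 0) (1 : ℝ))
    (EuclideanSpace.single (r 1) (1 : ℝ)) (EuclideanSpace.single (r 2) (1 : ℝ))
  simpa [PiLp.norm_single] using h

end Euclidean

/-! ## §3 THE END, BY NAME: the mixed constant `c∞` of one local analytic term from `(M, δ, |S|)` -/

section End

variable {n : ℕ} {E : (Fin n → ℂ) → ℂ} {U : Set (Fin n → ℂ)} {M : ℝ}

/-- Index triples with values in `S` passing through a given position form at most `|S|³` of them (the trivial count `≤ |S³|`; the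
sharp `|S|²` is not needed downstream). [folklore] -/
theorem card_filter_piFinset_le (S : Finset (Fin n)) (s : Fin 3) (j : Fin n) :
    ((Fintype.piFinset fun _ : Fin 3 => S).filter (fun r => r s = j)).card ≤ S.card ^ 3 := by
  calc ((Fintype.piFinset fun _ : Fin 3 => S).filter (fun r => r s = j)).card ≤ (Fintype.piFinset fun _ : Fin 3 => S).card :=
        Finset.card_filter_le _ _
    _ = S.card ^ 3 := by rw [Fintype.card_piFinset_const]

/-- **THE MIXED LETTER OF ONE LOCAL ANALYTIC TERM, IN PRINT's CURRENCY** (`…ConvexWindowSuppliersLocal.thirdDeriv_supNorm_of_local`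
BY NAME with `N = S³`, `τ = 27M∕δ³`, `ν = |S|³`): `E ∈ C³(U)` over `ℂ` with `‖E‖ ≤ M` (`M ≥ 0`) on an open `U ⊆ ℂⁿ`, depending only
on the coordinates in `S`, and a real window `K ⊆ ℓ²` whose closed complex `δ`-polydiscs lie in `U` ⟹ for `z ∈ K` and every `w`,
`‖D³P(z)[w,·,·]‖_op ≤ (|S|³·27M∕δ³)·‖w‖_∞` — the `c·N(w)` letter of `…ConvexWindowSuppliersBox` §3 with an INTENSIVE `c`. [folklore] -/
theorem thirdDeriv_supNorm_of_analyticLocal (hU : IsOpen U) (hE : ContDiffOn ℂ 3 E U) (hM0 : 0 ≤ M)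
    (hM : ∀ q ∈ U, ‖E q‖ ≤ M) (S : Finset (Fin n)) (hloc : ∀ z z' : Fin n → ℂ, (∀ i ∈ S, z i = z' i) → E z = E z')
    {K : Set (EuclideanSpace ℝ (Fin n))} {δ : ℝ} (hδ : 0 < δ) (hK : ∀ z ∈ K, closedBall (fun i => (z i : ℂ)) δ ⊆ U) :
    ∀ z ∈ K, ∀ w : EuclideanSpace ℝ (Fin n),
      ‖fderiv ℝ (iteratedFDeriv ℝ 2 (fun y : EuclideanSpace ℝ (Fin n) => (E (fun i => (y i : ℂ))).re)) z w‖ ≤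
        ((S.card ^ 3 : ℕ) * (27 * M / δ ^ 3)) * ‖WithLp.ofLp w‖ :=
  ConvexWindowSuppliersLocal.thirdDeriv_supNorm_of_local (Fintype.piFinset fun _ : Fin 3 => S) (by positivity)
    (fun z hz r hr => iteratedFDeriv_three_single_eq_zero_of_local hU hE S hloc (hK z hz (mem_closedBall_self hδ.le))
      (by simpa [Fintype.mem_piFinset] using hr))
    (fun z hz r _ => abs_iteratedFDeriv_three_single_le hU hE hM hδ (hK z hz) r)
    (fun j => card_filter_piFinset_le S 1 j) (fun k => card_filter_piFinset_le S 2 k)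

end End

end Summit.QuantumFields.BalabanUV.T4Continuum.NE7b.AnalyticThirdDerivLetterLocal
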